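import Summits.CriticalPhenomena.PercolationContinuityZ3.Theorems.PercNearOneGluingNoHeavyLowerTailSahiCTCC2ThreeRowThree
import Summits.CriticalPhenomena.PercolationContinuityZ3.Theorems.PercNearOneGluingNoHeavyLowerTailSahiCTCC2ThreeFourPoint
import Summits.CriticalPhenomena.PercolationContinuityZ3.Theorems.PercNearOneGluingNoHeavyLowerTailSahiCTCC2TopSlice
import HarnessLib

/-!
# `NoHeavyLowerTail` (crux stmt-CriticalPhenomena-4575), P3 lane: THE LEVEL-3 MONOTONICITY C2 OUTSIDE THE TWO LOW ROWS —
# `coeff_{m+e_v} R_3 ≤ coeff_m R_3` (`m_v = 2`) for every pair of up-sets and every vertex, at every profile that has an entry `≥ 3` off `v` or at least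
# three further doubled points; so `R_3 ∈ ℕ[s]` is reduced to C2 at the profiles `≤ 2` with at most two doubled points off `v`

Support file (seat `prim-l12-p3`, gen 43; `--supports stmt-CriticalPhenomena-4575`).  Memo
`run/shared/lean/prim/prim-l12/FROM-prim-l12-p3-g43-C2-LEVEL-THREE.md`.  Memo g27 §4 reduced `R_t ∈ ℕ[s]` to the one-vertex monotonicity C2, and g42
proved C2 at level `2` (`…SahiCTCC2LevelTwo`).  At level `3` this file assembles:
* `…SahiCTCC2TopSlice.coeff_Rt_three_C2_of_three_le` : an entry `≥ 3` off `v` (top slice = `R_2` of the section cylinders);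
* `…SahiCTCC2ThreeForm.coeff_Rt_three_C2_of_four_le` : at least four doubled points off `v` (the subtracted small-set block vanishes);
* **row 3** (`coeff_C2three_nonneg_of_three_dbl`, `coeff_Rt_three_C2_of_three_dbl`): exactly three doubled points off `v` and entries `≤ 2` —
  `…SahiCTCC2ThreeRowThree.fourPoint_le_coeff_C2three` (all single points dropped by the monotonicity of the Kleitman surplus) and the
  kernel-checked four-point inequality `…SahiCTCC2ThreeFourPoint.fourPoint_nonneg`;
into **`coeff_Rt_three_C2_of_not_low`**, and states the remaining target precisely: **`coeff_Rt_three_nonneg_of_lowRows`** — if C2 holds for the pair at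
the profiles `≤ 2` with at most two doubled points off the vertex ("rows 0, 1, 2" of the memo), then `R_3(𝒳,𝒵) ∈ ℕ[s]` (the lane's named gap, memo
g27/g42; value level: the lumped threshold correlation `TP_3`).  Nothing is asserted about the crux; rows 0–2 are NOT proved here.
-/

noncomputable section

open scoped Classical

namespace Summit.CriticalPhenomena.PercolationContinuityZ3.Theorems.SahiCTCForms

open Finset MvPolynomial SahiCTCGenFun

variable {α : Type*} [DecidableEq α] [Fintype α]

variable {F G : Finset (Finset α)}

/-- **Row 3 of C2 at level 3** (crossed form): for up-sets `𝒳, 𝒵`, a vertex `v` and a `v`-free profile `m ≤ 2` with exactly three doubled points,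
the coefficient of `P₂ − P₃` (C2 difference of `R_3` at `v`) is `≥ 0`. [this work] -/
theorem coeff_C2three_nonneg_of_three_dbl (hF : IsUpperSet (F : Set (Finset α))) (hG : IsUpperSet (G : Set (Finset α))) (v : α)
    {m : α →₀ ℕ} (hv : m v = 0) (h2 : ∀ i, m i ≤ 2) (h3 : #(dbl m) = 3) :
    0 ≤ (RlumpVx (bySize (· < 3)) F G v 2 - RlumpVx (bySize (· < 3)) F G v 3).coeff m := by
  obtain ⟨d₁, d₂, d₃, h12, h13, h23, hdbl⟩ := card_eq_three.1 h3
  have hd : ∀ {d : α}, d ∈ dbl m → v ≠ d := fun hd h => by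
    have := mem_dbl_iff.1 hd; rw [← h, hv] at this; exact absurd this (by norm_num)
  have hv1 : v ≠ d₁ := hd (by rw [hdbl]; simp)
  have hv2 : v ≠ d₂ := hd (by rw [hdbl]; simp)
  have hv3 : v ≠ d₃ := hd (by rw [hdbl]; simp)
  exact (fourPoint_nonneg hF hG hv1 hv2 hv3 h12 h13 h23).trans (fourPoint_le_coeff_C2three hF hG hv h2 hdbl h12 h13 h23)

/-- **C2 of `R_3` at every profile `≤ 2` with exactly three doubled points off the vertex.** [this work] -/
theorem coeff_Rt_three_C2_of_three_dbl (hF : IsUpperSet (F : Set (Finset α))) (hG : IsUpperSet (G : Set (Finset α)))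
    (m : α →₀ ℕ) (v : α) (hv : m v = 2) (h2 : ∀ i, m i ≤ 2) (h3 : #((dbl m).erase v) = 3) :
    (Rt 3 F G).coeff (m + Finsupp.single v 1) ≤ (Rt 3 F G).coeff m := by
  set m₀ := m - Finsupp.single v 2 with hm₀
  have hm₀v : m₀ v = 0 := by rw [hm₀, Finsupp.tsub_apply, Finsupp.single_eq_same, hv]
  have hm_eq : m = m₀ + Finsupp.single v 2 := by
    rw [hm₀, tsub_add_cancel_of_le]
    rw [Finsupp.single_le_iff, hv]
  have h3' : m + Finsupp.single v 1 = m₀ + Finsupp.single v 3 := by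
    rw [hm_eq, add_assoc, ← Finsupp.single_add]
  have hd : #(dbl m₀) = 3 := by rw [hm₀, dbl_tsub_single_two hv]; exact h3
  have h2' : ∀ i, m₀ i ≤ 2 := fun i => by rw [hm₀, Finsupp.tsub_apply]; exact le_trans (Nat.sub_le _ _) (h2 i)
  rw [h3', hm_eq, Rt_eq_Rlump, coeff_Rlump_add_single _ F G v hm₀v (by norm_num),
    coeff_Rlump_add_single _ F G v hm₀v (by norm_num), ← sub_nonneg, ← coeff_sub]
  exact coeff_C2three_nonneg_of_three_dbl hF hG v hm₀v h2' hd

/-- **C2 OF `R_3` OUTSIDE THE TWO LOW ROWS.**  For up-sets `𝒳, 𝒵`, a vertex `v` and a profile `m` with `m_v = 2`: if some entry off `v` is `≥ 3`,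
or at least three entries off `v` equal `2`, then `coeff_{m+e_v} R_3(𝒳,𝒵) ≤ coeff_m R_3(𝒳,𝒵)`. [this work] -/
theorem coeff_Rt_three_C2_of_not_low (hF : IsUpperSet (F : Set (Finset α))) (hG : IsUpperSet (G : Set (Finset α)))
    (m : α →₀ ℕ) (v : α) (hv : m v = 2) (h : (∃ w, w ≠ v ∧ 3 ≤ m w) ∨ 3 ≤ #((dbl m).erase v)) :
    (Rt 3 F G).coeff (m + Finsupp.single v 1) ≤ (Rt 3 F G).coeff m := by
  by_cases h3 : ∃ w, w ≠ v ∧ 3 ≤ m w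
  · obtain ⟨w, hwv, hw⟩ := h3
    exact coeff_Rt_three_C2_of_three_le hF hG hwv.symm hv hw
  · have h2 : ∀ i, m i ≤ 2 := fun i => by
      by_cases hi : i = v
      · rw [hi, hv]
      · by_contra hlt; exact h3 ⟨i, hi, by omega⟩
    have hcard : 3 ≤ #((dbl m).erase v) := h.resolve_left h3
    by_cases h4 : 4 ≤ #((dbl m).erase v)
    · exact coeff_Rt_three_C2_of_four_le hF hG m v hv h4
    · exact coeff_Rt_three_C2_of_three_dbl hF hG m v hv h2 (by omega)

/-- **`R_3 ∈ ℕ[s]` FROM THE TWO LOW ROWS.**  If, for the pair `𝒳, 𝒵` of up-sets, C2 of `R_3` holds at every vertex `v` and every profile `m` with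
`m_v = 2`, all entries `≤ 2` and at most two doubled points off `v` (rows 0–2 of the memo: the genuinely "ladder-like" cases), then
`R_3(𝒳,𝒵) ∈ ℕ[s]` — the coefficientwise level-3 threshold correlation of the programme (memo g27 §4, g42, g43). [this work] -/
theorem coeff_Rt_three_nonneg_of_lowRows (hF : IsUpperSet (F : Set (Finset α))) (hG : IsUpperSet (G : Set (Finset α)))
    (hlow : ∀ (m : α →₀ ℕ) (v : α), m v = 2 → (∀ i, m i ≤ 2) → #((dbl m).erase v) ≤ 2 →
      (Rt 3 F G).coeff (m + Finsupp.single v 1) ≤ (Rt 3 F G).coeff m) (m : α →₀ ℕ) :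
    0 ≤ (Rt 3 F G).coeff m := by
  rw [Rt_eq_Rlump]
  refine coeff_Rlump_nonneg_of_C2 (isLowerSet_bySize_lt 3) hF hG (fun m v hv => ?_) m
  rw [← Rt_eq_Rlump]
  by_cases h : (∃ w, w ≠ v ∧ 3 ≤ m w) ∨ 3 ≤ #((dbl m).erase v)
  · exact coeff_Rt_three_C2_of_not_low hF hG m v hv h
  · rw [not_or, not_exists] at h
    refine hlow m v hv (fun i => ?_) (by have := h.2; omega)
    by_cases hi : i = v
    · rw [hi, hv]
    · have := h.1 i; rw [not_and, not_le] at this; have := this hi; omega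

end Summit.CriticalPhenomena.PercolationContinuityZ3.Theorems.SahiCTCForms
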